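import Literature.AlgebraicGeometry.HodgeTheory.FermatLinearSubspaceClass
import Literature.AlgebraicGeometry.HodgeTheory.HypersurfaceComplexPoints
import Literature.AlgebraicGeometry.Motives.ProjectiveSpaceLinearMapsPoints
import Literature.AlgebraicGeometry.Motives.ProjectiveSpaceLinearMapsClosedImmersion
import HarnessLib

/-!
# The complex points of Shioda's linear subspaces `L_{σ,ε} ⊆ X²ʳₘ`

Family `hodge`, layer `Literature/AlgebraicGeometry/HodgeTheory`. PROOF FILE (theorems only; no
definitions, no named facts) completing `FermatLinearSubspaceClass` (the embedding
`g = linearSubspaceEmb m σ ε : ℙʳ_ℂ ⟶ X²ʳₘ` of the linear subspace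
`L_{σ,ε} : xᵢ = εᵢ x_{σ i}` (`i < σ i`, `εᵢᵐ = -1`; Shioda, Math. Ann. 245 (1979) §1 / Aoki, Thm. 1-1:
"the linear space `L`"), with `g(ℙʳ) ⊆ Z_{σ,ε} = X ∩ L` on scheme points) by the description of
its COMPLEX POINTS in homogeneous coordinates (GAGA dictionary `hypersurfacePoint`,
`HypersurfaceComplexPoints`; the action of linear maps on complex points,
`Motives.map_linSubstMap_projPoint_mk`):

* `isClosedImmersion_linearSubspaceEmb_left` — `g` is a CLOSED IMMERSION (the linear map
  `ℙʳ → ℙ²ʳ⁺¹` is one, `Motives.ProjectiveSpace.isClosedImmersion_linSubstMap_left`, and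
  `g ≫ (X ↪ ℙ)` is it; Hartshorne II Ex. 3.11 (d), Ex. 3.12);
* `aeval_pairedSubst_lineParam`, `lineParam_ne_zero` — the parametrisation inverts on `L`:
  for `z` with `zᵢ = εᵢ z_{σ i}` the vector `y_{[i]} = z_{σ i}` (`i < σ i`) has `τ(y) = z`;
* `pt_mem_fermatLinearSection_iff` — a complex point `P ∈ X²ʳₘ(ℂ)` with homogeneous
  coordinates `[z]` lies on `Z_{σ,ε}` iff `zᵢ = εᵢ z_{σ i}` for all `i < σ i`;
* `pt_mem_range_linearSubspaceEmb_iff` — **`P` lies on `g(ℙʳ)` iff `zᵢ = εᵢ z_{σ i}` for all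
  `i < σ i`** (so `g(ℙʳ)(ℂ) = Z_{σ,ε}(ℂ) = L_{σ,ε}(ℂ) ∩ X(ℂ)`);
* `map_linearSubspaceEmb_projPoint_mk`, `hypersurfacePoint_map_linearSubspaceEmb` — the
  coordinates `[τ(y)]` of `g([y])`;
* `complexBetti_map_eq_zero_of_restrictCompl_eq_zero` — bookkeeping: a class dying off `S ⊆ X`
  pulls back to `0` along any morphism whose complex points avoid `S`.

## References

* [Shioda1979HodgeFermat] T. Shioda, The Hodge conjecture for Fermat varieties, Math. Ann. 245
  (1979) 175–184, §1.
* [Aoki1987] N. Aoki, Some new algebraic cycles on Fermat varieties, J. Math. Soc. Japan 39 (1987),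
  Thm. 1-1.
* [Hartshorne1977] R. Hartshorne, Algebraic Geometry (1977), II Ex. 2.14, Ex. 3.11 (d), Ex. 3.12.
* [SerreGAGA1956] J.-P. Serre, GAGA, Ann. Inst. Fourier 6 (1956), §2 n°5.
-/

noncomputable section

open scoped LinearAlgebra.Projectivization
open CategoryTheory AlgebraicGeometry MvPolynomial Finset
open Literature.AlgebraicGeometry.Motives Literature.AlgebraicTopology.SingularHomology
open Literature.NumberTheory.Transcendental

namespace Literature.AlgebraicGeometry.HodgeTheory

attribute [local instance] MvPolynomial.gradedAlgebra Motives.ProjBaseChange.algebraBase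

/-! ### Bookkeeping: pull-back along a morphism avoiding the support -/

/-- **A class dying on `(X ∖ S)(ℂ)` pulls back to `0` along a morphism whose complex points avoid
`S`**: `f(ℂ)` factors through the inclusion `(X ∖ S)(ℂ) ⊆ X(ℂ)`. [folklore] -/
theorem complexBetti_map_eq_zero_of_restrictCompl_eq_zero {X Y : Motives.SchemeOver ℂ} (f : Y ⟶ X)
    {S : Set X.left} (hS : ∀ Q : Motives.ComplexPoints Y, (Motives.AlgPoints.map f Q).pt ∉ S) {k : ℕ}
    {c : complexBetti X k} (hc : complexBetti.restrictCompl X S k c = 0) :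
    complexBetti.map f k c = 0 := by
  let f' : C(Motives.ComplexPoints Y, Motives.complexPointsCompl X S) :=
    ⟨fun Q ↦ ⟨Motives.AlgPoints.map f Q, hS Q⟩, (Motives.AlgPoints.continuous_map f).subtype_mk _⟩
  have hfac : Motives.AlgPoints.mapContinuous (L := ℂ) f =
      (⟨Subtype.val, continuous_subtype_val⟩ :
        C(Motives.complexPointsCompl X S, Motives.ComplexPoints X)).comp f' := rfl
  change singularCohomology.map ℂ ℂ (Motives.AlgPoints.mapContinuous (L := ℂ) f) k c = 0
  rw [hfac, singularCohomology.map_comp, ModuleCat.comp_apply]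
  change singularCohomology.map ℂ ℂ f' k (complexBetti.restrictCompl X S k c) = 0
  rw [hc, map_zero]

/-! ### Homogeneous coordinates of complex points of an embedded scheme and zero loci -/

section Coordinates

variable {n : ℕ} {Y : Motives.SchemeOver ℂ} (ι : Y ⟶ Motives.projectiveSpace (n + 1) ℂ)

/-- The grading of `ℂ[x₀, …, x_{n+1}]` by degree. -/
local notation "𝓐" => MvPolynomial.homogeneousSubmodule (Fin (n + 2)) ℂ

/-- **A form vanishes at the homogeneous coordinates of a complex point iff it lies in the
homogeneous prime of the underlying scheme point** (for forms of positive degree): `[z] = ι(P)` in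
coordinates, `G ∈ 𝔭_{ι(P)} ⟺ ι(P) ∉ D₊(G) ⟺ G(z) = 0`
(`pt_projPoint_mk_mem_basicOpen_iff`). [cite: SerreGAGA1956, §2 n°5] -/
theorem mem_asHomogeneousIdeal_pt_map_iff (P : Motives.ComplexPoints Y) {z : Fin (n + 2) → ℂ}
    (hz : z ≠ 0) (hP : hypersurfacePoint ι P = Projectivization.mk ℂ z hz)
    {G : MvPolynomial (Fin (n + 2)) ℂ} {d : ℕ} (hd : 0 < d) (hG : G ∈ 𝓐 d) :
    G ∈ ((Motives.AlgPoints.map ι P).pt : ProjectiveSpectrum 𝓐).asHomogeneousIdeal ↔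
      MvPolynomial.eval z G = 0 := by
  have key := pt_projPoint_mk_mem_basicOpen_iff (n + 1) z hz hd hG
  rw [← hP, projPoint_hypersurfacePoint] at key
  have key' : G ∉ ((Motives.AlgPoints.map ι P).pt : ProjectiveSpectrum 𝓐).asHomogeneousIdeal ↔
      MvPolynomial.eval z G ≠ 0 := key
  tauto

/-- **Membership of the underlying point in a zero locus of forms of positive degree, in
coordinates**: `ι(P) ∈ V₊(S) ⟺ G(z) = 0` for all `G ∈ S`. [cite: SerreGAGA1956, §2 n°5] -/
theorem pt_map_mem_zeroLocus_iff (P : Motives.ComplexPoints Y) {z : Fin (n + 2) → ℂ}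
    (hz : z ≠ 0) (hP : hypersurfacePoint ι P = Projectivization.mk ℂ z hz)
    {S : Set (MvPolynomial (Fin (n + 2)) ℂ)} (hS : ∀ G ∈ S, ∃ d, 0 < d ∧ G ∈ 𝓐 d) :
    (Motives.AlgPoints.map ι P).pt ∈ ProjectiveSpectrum.zeroLocus 𝓐 S ↔
      ∀ G ∈ S, MvPolynomial.eval z G = 0 := by
  change S ⊆ ((Motives.AlgPoints.map ι P).pt : ProjectiveSpectrum 𝓐).asHomogeneousIdeal ↔ _
  refine ⟨fun h G hG ↦ ?_, fun h G hG ↦ ?_⟩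
  · obtain ⟨d, hd, hGd⟩ := hS G hG
    exact (mem_asHomogeneousIdeal_pt_map_iff ι P hz hP hd hGd).mp (h hG)
  · obtain ⟨d, hd, hGd⟩ := hS G hG
    exact (mem_asHomogeneousIdeal_pt_map_iff ι P hz hP hd hGd).mpr (h G hG)

end Coordinates

/-! ### The parametrisation of `L_{σ,ε}` and its inverse on points -/

section Param

variable {r m : ℕ} {σ : Equiv.Perm (Fin (2 * r + 2))} (h1 : ∀ i, σ i ≠ i) (h2 : ∀ i, σ (σ i) = i)
  (ε : Fin (2 * r + 2) → ℂ)

/-- `(εᵢ y_{[i]})` evaluated: for a smaller element `i < σ i`, `σ_τ(xᵢ)(y) = εᵢ y_{[i]}`. [folklore] -/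
theorem aeval_pairedSubst_of_lt (y : Fin (r + 1) → ℂ) {i : Fin (2 * r + 2)} (hi : i < σ i) :
    aeval y (pairedSubst σ ε i) = ε i * y (pairOrbitIndex σ i) := by
  rw [pairedSubst, if_pos hi, map_mul, aeval_C, aeval_X, Algebra.algebraMap_self, RingHom.id_apply]

include h2 in
/-- For the larger element `σ i` of the orbit of `i < σ i`, `σ_τ(x_{σ i})(y) = y_{[i]}`. [folklore] -/
theorem aeval_pairedSubst_perm (y : Fin (r + 1) → ℂ) {i : Fin (2 * r + 2)} (hi : i < σ i) :
    aeval y (pairedSubst σ ε (σ i)) = y (pairOrbitIndex σ i) := by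
  rw [pairedSubst, if_neg (not_lt_perm_perm h2 hi), aeval_X, pairOrbitIndex_perm h2]

include h1 h2 in
/-- The numbering `e` of the smaller elements inverts `pairOrbitIndex` on them:
`e [i] = i` for `i < σ i`. [folklore] -/
theorem orderEmbOfFin_pairOrbitIndex {i : Fin (2 * r + 2)} (hi : i < σ i) :
    Finset.orderEmbOfFin _ (card_filter_lt_perm h1 h2) (pairOrbitIndex σ i) = i := by
  have hcard := card_filter_lt_perm h1 h2
  have hmin : min i (σ i) = i := min_eq_left hi.le
  have hmem : min i (σ i) ∈ ({i | i < σ i} : Finset (Fin (2 * r + 2))) :=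
    hmin ▸ min_mem_filter_lt h1 h2 i
  have hidx : pairOrbitIndex σ i = (Finset.orderIsoOfFin _ hcard).symm ⟨min i (σ i), hmem⟩ := by
    rw [pairOrbitIndex, dif_pos hcard, dif_pos hmem]
  rw [hidx, ← Finset.coe_orderIsoOfFin_apply, OrderIso.apply_symm_apply]
  exact hmin

include h1 h2 in
/-- **The parametrisation inverts on the line**: for `z` with `zᵢ = εᵢ z_{σ i}` (`i < σ i`), the
parameter vector `y_j = z_{σ (e j)}` (the coordinates of `z` at the LARGER elements of the orbits)
satisfies `τ(y) = z`, i.e. `σ_τ(xᵢ)(y) = zᵢ` for every `i`. [cite: Aoki1987, Thm. 1-1] -/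
theorem aeval_pairedSubst_lineParam {z : Fin (2 * r + 2) → ℂ}
    (hz : ∀ i, i < σ i → z i = ε i * z (σ i)) (i : Fin (2 * r + 2)) :
    aeval (fun j ↦ z (σ (Finset.orderEmbOfFin _ (card_filter_lt_perm h1 h2) j))) (pairedSubst σ ε i) =
      z i := by
  by_cases hi : i < σ i
  · rw [aeval_pairedSubst_of_lt ε _ hi, orderEmbOfFin_pairOrbitIndex h1 h2 hi, ← hz i hi]
  · -- `i = σ i₀` with `i₀ = σ i < i`
    have hi₀ : σ i < σ (σ i) := by
      rw [h2]
      exact lt_of_le_of_ne (not_lt.mp hi) (h1 i)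
    have key := aeval_pairedSubst_perm h2 ε
      (fun j ↦ z (σ (Finset.orderEmbOfFin _ (card_filter_lt_perm h1 h2) j))) hi₀
    rw [h2] at key
    rw [key]
    change z (σ (Finset.orderEmbOfFin _ (card_filter_lt_perm h1 h2) (pairOrbitIndex σ (σ i)))) = z i
    rw [orderEmbOfFin_pairOrbitIndex h1 h2 hi₀, h2]

include h1 h2 in
/-- The parameter vector of a non-zero `z` on the line is non-zero. [folklore] -/
theorem lineParam_ne_zero {z : Fin (2 * r + 2) → ℂ} (hz : ∀ i, i < σ i → z i = ε i * z (σ i))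
    (hz0 : z ≠ 0) :
    (fun j ↦ z (σ (Finset.orderEmbOfFin _ (card_filter_lt_perm h1 h2) j))) ≠ 0 := by
  intro hy
  apply hz0
  funext i
  rw [← aeval_pairedSubst_lineParam h1 h2 ε hz i, hy, Pi.zero_apply]
  -- a form with no constant term vanishes at `0`
  unfold pairedSubst
  split_ifs <;> simp

end Param

/-! ### The complex points of `g : ℙʳ ⟶ X²ʳₘ` -/

section Points

variable {r m : ℕ} {σ : Equiv.Perm (Fin (2 * r + 2))} (h1 : ∀ i, σ i ≠ i) (h2 : ∀ i, σ (σ i) = i)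
  (ε : Fin (2 * r + 2) → ℂ) (hε : ∀ i, i < σ i → ε i ^ m = -1)

/-- The grading of `ℂ[x₀, …, x_{2r+1}]` by degree. -/
local notation "𝓐" => MvPolynomial.homogeneousSubmodule (Fin (2 * r + 2)) ℂ
/-- Local notation: the closed immersion `X²ʳₘ ↪ ℙ²ʳ⁺¹`. -/
local notation "ιX" => SmoothHypersurface.hypersurfaceι (fermatPolynomial ℂ (2 * r) m)

/-- **`g : ℙʳ ⟶ X²ʳₘ` is a closed immersion** (its composite with `X ↪ ℙ²ʳ⁺¹` is the linear map
`ℙʳ → ℙ²ʳ⁺¹`, a closed immersion). [cite: Hartshorne1977, II Ex. 3.11 (d) and Ex. 3.12] -/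
theorem isClosedImmersion_linearSubspaceEmb_left :
    IsClosedImmersion (linearSubspaceEmb m h1 h2 ε hε).left := by
  have h : IsClosedImmersion ((linearSubspaceEmb m h1 h2 ε hε).left ≫ (ιX).left) := by
    rw [linearSubspaceEmb_left_comp_ι]
    exact ProjectiveSpace.isClosedImmersion_linSubstMap_left _ _ _
  exact IsClosedImmersion.of_comp_isClosedImmersion _ (ιX).left

/-- `g ≫ (X ↪ ℙ²ʳ⁺¹)` is the linear map, over `ℂ`. [folklore] -/
theorem linearSubspaceEmb_comp_ι :
    linearSubspaceEmb m h1 h2 ε hε ≫ ιX = pairedLinEmb h1 h2 ε :=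
  Over.OverMorphism.ext (by rw [Over.comp_left]; exact linearSubspaceEmb_left_comp_ι h1 h2 ε hε)

/-- **The coordinates of `g([y])`**: `(X ↪ ℙ)(g([y])) = [τ(y)]` on complex points.
[cite: Hartshorne1977, II Ex. 2.14] -/
theorem map_ι_map_linearSubspaceEmb_projPoint_mk (y : Fin (r + 1) → ℂ) (hy : y ≠ 0) :
    Motives.AlgPoints.map ιX (Motives.AlgPoints.map (linearSubspaceEmb m h1 h2 ε hε)
      (projPoint r (Projectivization.mk ℂ y hy))) =
      projPoint (2 * r + 1) (Projectivization.mk ℂ (fun i ↦ aeval y (pairedSubst σ ε i))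
        (ProjectiveSpace.linSubstVec_ne_zero _ (exists_pairedSubst_eq_X h1 h2 ε) hy)) := by
  rw [← Motives.AlgPoints.map_comp_apply, linearSubspaceEmb_comp_ι]
  exact Motives.map_linSubstMap_projPoint_mk _ _ _ y hy

/-- **The homogeneous coordinates of `g([y])` are `[τ(y)]`.** [cite: Hartshorne1977, II Ex. 2.14] -/
theorem hypersurfacePoint_map_linearSubspaceEmb (y : Fin (r + 1) → ℂ) (hy : y ≠ 0) :
    hypersurfacePoint ιX (Motives.AlgPoints.map (linearSubspaceEmb m h1 h2 ε hε)
      (projPoint r (Projectivization.mk ℂ y hy))) =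
      Projectivization.mk ℂ (fun i ↦ aeval y (pairedSubst σ ε i))
        (ProjectiveSpace.linSubstVec_ne_zero _ (exists_pairedSubst_eq_X h1 h2 ε) hy) :=
  hypersurfacePoint_eq_of_projPoint_eq _ _ (by
    rw [← map_ι_map_linearSubspaceEmb_projPoint_mk h1 h2 ε hε y hy])

/-- **A complex point lies on `Z_{σ,ε} = X ∩ L_{σ,ε}` iff its coordinates satisfy
`zᵢ = εᵢ z_{σ i}` for all `i < σ i`.** [cite: Aoki1987, Thm. 1-1] -/
theorem pt_mem_fermatLinearSection_iff (P : Motives.ComplexPoints (fermatHypersurface (2 * r) m))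
    {z : Fin (2 * r + 2) → ℂ} (hz : z ≠ 0) (hP : hypersurfacePoint ιX P = Projectivization.mk ℂ z hz) :
    P.pt ∈ fermatLinearSection m σ ε ↔ ∀ i, i < σ i → z i = ε i * z (σ i) := by
  change (Motives.AlgPoints.map ιX P).pt ∈
    ProjectiveSpectrum.zeroLocus 𝓐 (pairedLinearForm σ ε '' {i | i < σ i}) ↔ _
  refine (pt_map_mem_zeroLocus_iff ιX P hz hP (S := pairedLinearForm σ ε '' {i | i < σ i}) (by
    rintro _ ⟨i, -, rfl⟩
    exact ⟨1, one_pos, (mem_homogeneousSubmodule 1 _).mpr (isHomogeneous_pairedLinearForm σ ε i)⟩)).trans ?_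
  simp only [Set.forall_mem_image, Set.mem_setOf_eq, pairedLinearForm, map_sub, map_mul, eval_C,
    eval_X, sub_eq_zero]

/-- **The complex points of `g(ℙʳ)` are those of `Z_{σ,ε}`**: a complex point `P` of `X²ʳₘ` with
coordinates `[z]` lies on the image of `g` iff `zᵢ = εᵢ z_{σ i}` for all `i < σ i` — the image is
contained in `Z_{σ,ε}` (`range_linearSubspaceEmb_subset`), and conversely such a `P` is `g([y])`
for the parameter vector `y` of `z` (`aeval_pairedSubst_lineParam`: `τ(y) = z`; complex points of
`X` are separated by `X ↪ ℙ`). [cite: Aoki1987, Thm. 1-1] [cite: SerreGAGA1956, §2 n°5] -/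
theorem pt_mem_range_linearSubspaceEmb_iff (P : Motives.ComplexPoints (fermatHypersurface (2 * r) m))
    {z : Fin (2 * r + 2) → ℂ} (hz : z ≠ 0) (hP : hypersurfacePoint ιX P = Projectivization.mk ℂ z hz) :
    P.pt ∈ Set.range (linearSubspaceEmb m h1 h2 ε hε).left.base ↔ ∀ i, i < σ i → z i = ε i * z (σ i) := by
  constructor
  · intro h
    exact (pt_mem_fermatLinearSection_iff ε P hz hP).mp (range_linearSubspaceEmb_subset h1 h2 ε hε h)
  · intro h
    set y : Fin (r + 1) → ℂ := fun j ↦ z (σ (Finset.orderEmbOfFin _ (card_filter_lt_perm h1 h2) j))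
      with hy
    have hy0 : y ≠ 0 := lineParam_ne_zero h1 h2 ε h hz
    have hτ : (fun i ↦ aeval y (pairedSubst σ ε i)) = z := funext (aeval_pairedSubst_lineParam h1 h2 ε h)
    set Q := Motives.AlgPoints.map (linearSubspaceEmb m h1 h2 ε hε) (projPoint r (Projectivization.mk ℂ y hy0))
      with hQ
    have hQP : Q = P := by
      apply (Motives.AlgPoints.isEmbedding_map_of_isClosedImmersion (L := ℂ) ιX).injective
      rw [hQ, map_ι_map_linearSubspaceEmb_projPoint_mk, ← projPoint_hypersurfacePoint ιX P, hP]
      congr 1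
      exact (Projectivization.mk_eq_mk_iff' ℂ _ _ _ _).mpr ⟨1, by rw [one_smul]; exact hτ.symm⟩
    refine ⟨(projPoint r (Projectivization.mk ℂ y hy0)).pt, ?_⟩
    rw [← hQP]
    rfl

end Points

end Literature.AlgebraicGeometry.HodgeTheory

end
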